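import Summits.CriticalPhenomena.PercolationContinuityZ3.Theorems.PercNearOneGluingNoHeavyLowerTailKNGoodSeriesGlue
import HarnessLib

/-!
# The SERIES STEP for Kozma–Nitzan GOODNESS: an observer with two Steiner neighbours, modulo one gluing inequality
# (`NoHeavyLowerTail` cell, stmt-CriticalPhenomena-4575; prover `prim-hp-2`, deletion–contraction line, gen 3)

Support file (`--supports stmt-CriticalPhenomena-4575`).  No definitions, no named facts, no sorries.
Setting: `o ∉ A` whose positive-weight pairs go only to two vertices `x ≠ y` (any further structure at `x, y` allowed),
`α = w(ox)`, `β = w(oy)`, `w⁰ = G − o` (pairs at `o` closed, `pinW`), `b ≠ o` the sink, and for a weight function `u`, observer `v` and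
relay `a`:  `agood(u, v; a) := P_u(v ↔ b) − P_u(a ↔ b) + Σ_{W ∩ A = ∅} P_u(C(v) = W)·min_{a′∈A} P_u(a′ ↔ b off W)` (Kozma–Nitzan's
goodness functional with explicit witness; `KNGood u A v b ⟺ agood(u, v; argmin) ≥ 0`).

* `KNGoodSeries.agood_series_identity` — **the series identity** (exact, deletion–contraction in the two pairs at `o`):
  `agood(G, o; a) = (1−α)(1−β)·[min_{a′} P_{w⁰}(a′ ↔ b) − P_{w⁰}(a ↔ b)] + α(1−β)·agood(w⁰, x; a) + (1−α)β·agood(w⁰, y; a)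
                   + αβ·agood(w⁰[xy ↦ 1], x; a)`
  (`agood` is affine in each pair at the observer — tools I —, and the four corners are the isolated observer, the observer glued
  into `x`, into `y`, and into both = the observer `x` of `(G − o) + xy` — tools II).
* `KNGoodSeries.knGood_series_of_bracket` — hence **`(G, A, o, b)` is good as soon as the right-hand side is `≥ 0` for SOME relay `a`.**
  With `a = a₀ := argmin_{a′} P_{w⁰}(a′ ↔ b)` the first term vanishes, the next two are the goodness slacks of `x` and `y` in `G − o`
  (Kozma–Nitzan Thm 4/5 classes, or any proved class), and the last is the GLUING INEQUALITY
  `GC(x,y): P_{(G−o)+xy}(x ↔ b) + D((G−o)+xy, x) ≥ P_{(G−o)+xy}(a₀ ↔ b)` of the seat notes (Conjecture M for one Steiner pair) — proved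
  when `a₀` is no lonelier than `x` or `y` in `G − o` (`KNGoodHair.glueTransfer_openConn`), open otherwise; 0 violations in > 10⁴ exact
  instances.  `KNGoodSeries.knGood_series_of_gluing` packages exactly this: good(G−o, x) ∧ good(G−o, y) ∧ GC ⇒ good(G, o).
  Relay hairs at `o` are then free (`KNGoodHair.knGood_of_deleteHairs`).
-/

noncomputable section

namespace Summit.CriticalPhenomena.PercolationContinuityZ3.Theorems

open MeasureTheory Set Literature.Probability.LatticeModels Literature.Probability.Percolation
open scoped Classical BigOperators

variable {n : ℕ}

namespace KNGoodSeries

open ChampionStability KNGoodAux KNGoodHair RelayNbhd CILTwoSteiner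

/-- **The series identity for the goodness functional.**  `o ∉ A` with positive-weight pairs only to `x ≠ y` (both `≠ o`), `a ∈ A`,
`b ≠ o`; `w⁰ = pinW w {pairs at o} ∅`, `α = w s(o,x)`, `β = w s(o,y)`:
`agood(w, o; a) = (1−α)(1−β)[min P_{w⁰}(· ↔ b) − P_{w⁰}(a ↔ b)] + α(1−β) agood(w⁰, x; a) + (1−α)β agood(w⁰, y; a) + αβ agood(w⁰[xy↦1], x; a)`.
[cite: KozmaNitzan2024, §3.2 Definition (p. 12), Thm. 5 (pp. 13–14) — extension to two neighbours] -/
theorem agood_series_identity (w : Sym2 (Fin n) → unitInterval) (A : Finset (Fin n)) (hA : A.Nonempty) (o x y a b : Fin n)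
    (ho : o ∉ A) (hxo : x ≠ o) (hyo : y ≠ o) (hxy : x ≠ y) (ha : a ∈ A) (hbo : b ≠ o)
    (hiso : ∀ v : Fin n, v ≠ o → v ≠ x → v ≠ y → (w s(o, v) : ℝ) = 0) :
    (prodBernoulli w).real (openConn o b) - (prodBernoulli w).real (openConn a b) +
        ∑ W ∈ nullSets A, (prodBernoulli w).real (clusterIs o W) *
          A.inf' hA (fun a' => (prodBernoulli w).real (openConnIn ((↑W : Set (Fin n))ᶜ) a' b)) =
      (1 - (w s(o, x) : ℝ)) * (1 - (w s(o, y) : ℝ)) *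
          (A.inf' hA (fun a' => (prodBernoulli (pinW w {e : Sym2 (Fin n) | o ∈ e ∧ ¬ e.IsDiag} ∅)).real (openConn a' b)) -
            (prodBernoulli (pinW w {e : Sym2 (Fin n) | o ∈ e ∧ ¬ e.IsDiag} ∅)).real (openConn a b)) +
      (w s(o, x) : ℝ) * (1 - (w s(o, y) : ℝ)) *
          ((prodBernoulli (pinW w {e : Sym2 (Fin n) | o ∈ e ∧ ¬ e.IsDiag} ∅)).real (openConn x b) -
            (prodBernoulli (pinW w {e : Sym2 (Fin n) | o ∈ e ∧ ¬ e.IsDiag} ∅)).real (openConn a b) +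
            ∑ W ∈ nullSets A, (prodBernoulli (pinW w {e : Sym2 (Fin n) | o ∈ e ∧ ¬ e.IsDiag} ∅)).real (clusterIs x W) *
              A.inf' hA (fun a' => (prodBernoulli (pinW w {e : Sym2 (Fin n) | o ∈ e ∧ ¬ e.IsDiag} ∅)).real
                (openConnIn ((↑W : Set (Fin n))ᶜ) a' b))) +
      (1 - (w s(o, x) : ℝ)) * (w s(o, y) : ℝ) *
          ((prodBernoulli (pinW w {e : Sym2 (Fin n) | o ∈ e ∧ ¬ e.IsDiag} ∅)).real (openConn y b) -
            (prodBernoulli (pinW w {e : Sym2 (Fin n) | o ∈ e ∧ ¬ e.IsDiag} ∅)).real (openConn a b) +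
            ∑ W ∈ nullSets A, (prodBernoulli (pinW w {e : Sym2 (Fin n) | o ∈ e ∧ ¬ e.IsDiag} ∅)).real (clusterIs y W) *
              A.inf' hA (fun a' => (prodBernoulli (pinW w {e : Sym2 (Fin n) | o ∈ e ∧ ¬ e.IsDiag} ∅)).real
                (openConnIn ((↑W : Set (Fin n))ᶜ) a' b))) +
      (w s(o, x) : ℝ) * (w s(o, y) : ℝ) *
          ((prodBernoulli (Function.update (pinW w {e : Sym2 (Fin n) | o ∈ e ∧ ¬ e.IsDiag} ∅) s(x, y) 1)).real (openConn x b) -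
            (prodBernoulli (Function.update (pinW w {e : Sym2 (Fin n) | o ∈ e ∧ ¬ e.IsDiag} ∅) s(x, y) 1)).real (openConn a b) +
            ∑ W ∈ nullSets A, (prodBernoulli (Function.update (pinW w {e : Sym2 (Fin n) | o ∈ e ∧ ¬ e.IsDiag} ∅) s(x, y) 1)).real
                (clusterIs x W) *
              A.inf' hA (fun a' => (prodBernoulli (Function.update (pinW w {e : Sym2 (Fin n) | o ∈ e ∧ ¬ e.IsDiag} ∅) s(x, y) 1)).real
                (openConnIn ((↑W : Set (Fin n))ᶜ) a' b))) := by
  have hox : o ≠ x := fun h => hxo h.symm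
  have hoy : o ≠ y := fun h => hyo h.symm
  set w0 : Sym2 (Fin n) → unitInterval := pinW w {e : Sym2 (Fin n) | o ∈ e ∧ ¬ e.IsDiag} ∅ with hw0
  set e : Sym2 (Fin n) := s(o, x) with he
  set f : Sym2 (Fin n) := s(o, y) with hf
  have hef : e ≠ f := by rw [he, hf]; intro h; exact hxy (Sym2.congr_right.1 h)
  have hfe : f ≠ e := fun h => hef h.symm
  have hw0e : w0 e = 0 := by rw [hw0, he]; exact pinW_star_mk w hxo
  have hw0f : w0 f = 0 := by rw [hw0, hf]; exact pinW_star_mk w hyo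
  -- `w` is `G − o` with the two pairs restored
  have hw : w = Function.update (Function.update w0 e (w e)) f (w f) := by
    funext e'
    by_cases h1 : e' = f
    · rw [h1, Function.update_self]
    · rw [Function.update_of_ne h1]
      by_cases h2 : e' = e
      · rw [h2, Function.update_self]
      · rw [Function.update_of_ne h2]
        by_cases hmem : e' ∈ {e : Sym2 (Fin n) | o ∈ e ∧ ¬ e.IsDiag}
        · obtain ⟨hoe, hdiag⟩ := hmem
          obtain ⟨v, rfl⟩ : ∃ v, e' = s(o, v) := by
            induction e' using Sym2.ind with
            | h a b =>
              rcases Sym2.mem_iff.1 hoe with rfl | rfl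
              · exact ⟨b, rfl⟩
              · exact ⟨a, Sym2.eq_swap⟩
          have hvo : v ≠ o := by
            intro h; apply hdiag; rw [h]; exact Sym2.mk_isDiag_iff.2 rfl
          have hvx : v ≠ x := by intro h; apply h2; rw [h, he]
          have hvy : v ≠ y := by intro h; apply h1; rw [h, hf]
          rw [hw0, pinW_star_mk w hvo]
          exact Subtype.ext (hiso v hvo hvx hvy)
        · rw [hw0, pinW_apply_of_not_mem w ∅ hmem]
  -- notation-free bookkeeping of the intermediate weight functions
  have hA0 : Function.update (Function.update w0 e (w e)) f 0 = Function.update w0 e (w e) := by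
    rw [Function.update_eq_self_iff, Function.update_of_ne hfe]; exact hw0f.symm
  have hB0 : Function.update w0 e 0 = w0 := Function.update_eq_self_iff.2 hw0e.symm
  have hC : Function.update (Function.update w0 e (w e)) f 1 = Function.update (Function.update w0 f 1) e (w e) :=
    Function.update_comm hef _ _ _
  have hC0 : Function.update (Function.update w0 f 1) e 0 = Function.update w0 f 1 := by
    rw [Function.update_eq_self_iff, Function.update_of_ne hef]; exact hw0e.symm
  have hC1 : Function.update (Function.update w0 f 1) e 1 = Function.update (Function.update w0 e 1) f 1 :=
    Function.update_comm hfe _ _ _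
  -- step A: affine in `f` at the observer; step B/C: affine in `e`
  have stepA := agood_affine_pair (Function.update w0 e (w e)) A hA o y a b (w f)
  rw [← hf, hA0, hC] at stepA
  have stepB := agood_affine_pair w0 A hA o x a b (w e)
  rw [← he, hB0] at stepB
  have stepC := agood_affine_pair (Function.update w0 f 1) A hA o x a b (w e)
  rw [← he, hC0, hC1] at stepC
  -- the four corners
  have c00 := agood_wzero_observer w A hA o a b ho hbo
  have c10 := agood_wzero_glue_one w A hA o x a b ho hxo ha hbo
  have c01 := agood_wzero_glue_one w A hA o y a b ho hyo ha hbo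
  have c11 := agood_wzero_glue_two w A hA o x y a b ho hxo hyo hxy ha hbo
  rw [← hw0] at c00 c10 c01 c11
  rw [← he] at c10 c11
  rw [← hf] at c01 c11
  rw [hw, stepA, stepB, stepC, c00, c10, c01, c11]
  have heq1 : (Function.update (Function.update w0 e (w e)) f (w f)) s(o, x) = w e := by
    rw [← he, Function.update_of_ne hef, Function.update_self]
  have heq2 : (Function.update (Function.update w0 e (w e)) f (w f)) s(o, y) = w f := by
    rw [← hf, Function.update_self]
  rw [heq1, heq2]
  ring

/-- **Goodness at an observer with two Steiner neighbours, from one bracket inequality.**  In the setting of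
`agood_series_identity`: if its right-hand side is `≥ 0` for some relay `a ∈ A`, then `(G, A, o, b)` is good.
[cite: KozmaNitzan2024, §3.2 (p. 12), Thm. 5 (pp. 13–14) — extension] -/
theorem knGood_series_of_bracket (w : Sym2 (Fin n) → unitInterval) (A : Finset (Fin n)) (hA : A.Nonempty) (o x y a b : Fin n)
    (ho : o ∉ A) (hxo : x ≠ o) (hyo : y ≠ o) (hxy : x ≠ y) (ha : a ∈ A) (hbo : b ≠ o)
    (hiso : ∀ v : Fin n, v ≠ o → v ≠ x → v ≠ y → (w s(o, v) : ℝ) = 0)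
    (hBr : 0 ≤
      (1 - (w s(o, x) : ℝ)) * (1 - (w s(o, y) : ℝ)) *
          (A.inf' hA (fun a' => (prodBernoulli (pinW w {e : Sym2 (Fin n) | o ∈ e ∧ ¬ e.IsDiag} ∅)).real (openConn a' b)) -
            (prodBernoulli (pinW w {e : Sym2 (Fin n) | o ∈ e ∧ ¬ e.IsDiag} ∅)).real (openConn a b)) +
      (w s(o, x) : ℝ) * (1 - (w s(o, y) : ℝ)) *
          ((prodBernoulli (pinW w {e : Sym2 (Fin n) | o ∈ e ∧ ¬ e.IsDiag} ∅)).real (openConn x b) -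
            (prodBernoulli (pinW w {e : Sym2 (Fin n) | o ∈ e ∧ ¬ e.IsDiag} ∅)).real (openConn a b) +
            ∑ W ∈ nullSets A, (prodBernoulli (pinW w {e : Sym2 (Fin n) | o ∈ e ∧ ¬ e.IsDiag} ∅)).real (clusterIs x W) *
              A.inf' hA (fun a' => (prodBernoulli (pinW w {e : Sym2 (Fin n) | o ∈ e ∧ ¬ e.IsDiag} ∅)).real
                (openConnIn ((↑W : Set (Fin n))ᶜ) a' b))) +
      (1 - (w s(o, x) : ℝ)) * (w s(o, y) : ℝ) *
          ((prodBernoulli (pinW w {e : Sym2 (Fin n) | o ∈ e ∧ ¬ e.IsDiag} ∅)).real (openConn y b) -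
            (prodBernoulli (pinW w {e : Sym2 (Fin n) | o ∈ e ∧ ¬ e.IsDiag} ∅)).real (openConn a b) +
            ∑ W ∈ nullSets A, (prodBernoulli (pinW w {e : Sym2 (Fin n) | o ∈ e ∧ ¬ e.IsDiag} ∅)).real (clusterIs y W) *
              A.inf' hA (fun a' => (prodBernoulli (pinW w {e : Sym2 (Fin n) | o ∈ e ∧ ¬ e.IsDiag} ∅)).real
                (openConnIn ((↑W : Set (Fin n))ᶜ) a' b))) +
      (w s(o, x) : ℝ) * (w s(o, y) : ℝ) *
          ((prodBernoulli (Function.update (pinW w {e : Sym2 (Fin n) | o ∈ e ∧ ¬ e.IsDiag} ∅) s(x, y) 1)).real (openConn x b) -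
            (prodBernoulli (Function.update (pinW w {e : Sym2 (Fin n) | o ∈ e ∧ ¬ e.IsDiag} ∅) s(x, y) 1)).real (openConn a b) +
            ∑ W ∈ nullSets A, (prodBernoulli (Function.update (pinW w {e : Sym2 (Fin n) | o ∈ e ∧ ¬ e.IsDiag} ∅) s(x, y) 1)).real
                (clusterIs x W) *
              A.inf' hA (fun a' => (prodBernoulli (Function.update (pinW w {e : Sym2 (Fin n) | o ∈ e ∧ ¬ e.IsDiag} ∅) s(x, y) 1)).real
                (openConnIn ((↑W : Set (Fin n))ᶜ) a' b)))) :
    KNGood w A hA o b := by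
  have hid := agood_series_identity w A hA o x y a b ho hxo hyo hxy ha hbo hiso
  rw [← hid] at hBr
  have hinf : A.inf' hA (fun a' => (prodBernoulli w).real (openConn a' b)) ≤ (prodBernoulli w).real (openConn a b) :=
    Finset.inf'_le _ ha
  rw [KNGood]
  linarith

/-- **The series step for goodness, modulo the gluing inequality.**  `o ∉ A` with positive-weight pairs only to `x ≠ y` (both `∉ A`... not
required: only `≠ o`), `b ≠ o`; let `a₀ ∈ A` minimise `P_{G−o}(· ↔ b)`.  If `(G − o, A, x, b)` and `(G − o, A, y, b)` are good and the
gluing inequality `P_{(G−o)+xy}(x ↔ b) + D((G−o)+xy, x) ≥ P_{(G−o)+xy}(a₀ ↔ b)` holds, then `(G, A, o, b)` is good.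
(`G − o = pinW w {pairs at o} ∅`, `(G−o)+xy` = the same with `s(x,y) ↦ 1`.) [cite: KozmaNitzan2024, Thm. 5 (pp. 13–14) — extension] -/
theorem knGood_series_of_gluing (w : Sym2 (Fin n) → unitInterval) (A : Finset (Fin n)) (hA : A.Nonempty) (o x y a₀ b : Fin n)
    (ho : o ∉ A) (hxo : x ≠ o) (hyo : y ≠ o) (hxy : x ≠ y) (ha₀ : a₀ ∈ A) (hbo : b ≠ o)
    (hiso : ∀ v : Fin n, v ≠ o → v ≠ x → v ≠ y → (w s(o, v) : ℝ) = 0)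
    (hmin : ∀ a' ∈ A, (prodBernoulli (pinW w {e : Sym2 (Fin n) | o ∈ e ∧ ¬ e.IsDiag} ∅)).real (openConn a₀ b) ≤
      (prodBernoulli (pinW w {e : Sym2 (Fin n) | o ∈ e ∧ ¬ e.IsDiag} ∅)).real (openConn a' b))
    (hgoodx : KNGood (pinW w {e : Sym2 (Fin n) | o ∈ e ∧ ¬ e.IsDiag} ∅) A hA x b)
    (hgoody : KNGood (pinW w {e : Sym2 (Fin n) | o ∈ e ∧ ¬ e.IsDiag} ∅) A hA y b)
    (hGC : (prodBernoulli (Function.update (pinW w {e : Sym2 (Fin n) | o ∈ e ∧ ¬ e.IsDiag} ∅) s(x, y) 1)).real (openConn a₀ b) ≤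
      (prodBernoulli (Function.update (pinW w {e : Sym2 (Fin n) | o ∈ e ∧ ¬ e.IsDiag} ∅) s(x, y) 1)).real (openConn x b) +
        ∑ W ∈ nullSets A, (prodBernoulli (Function.update (pinW w {e : Sym2 (Fin n) | o ∈ e ∧ ¬ e.IsDiag} ∅) s(x, y) 1)).real
            (clusterIs x W) *
          A.inf' hA (fun a' => (prodBernoulli (Function.update (pinW w {e : Sym2 (Fin n) | o ∈ e ∧ ¬ e.IsDiag} ∅) s(x, y) 1)).real
            (openConnIn ((↑W : Set (Fin n))ᶜ) a' b))) :
    KNGood w A hA o b := by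
  set μ0 := prodBernoulli (pinW w {e : Sym2 (Fin n) | o ∈ e ∧ ¬ e.IsDiag} ∅) with hμ0
  have hinf0 : A.inf' hA (fun a' => μ0.real (openConn a' b)) = μ0.real (openConn a₀ b) :=
    le_antisymm (Finset.inf'_le _ ha₀) ((Finset.le_inf'_iff hA _).2 hmin)
  have hx' := hgoodx
  have hy' := hgoody
  rw [KNGood, ← hμ0, hinf0] at hx' hy'
  refine knGood_series_of_bracket w A hA o x y a₀ b ho hxo hyo hxy ha₀ hbo hiso ?_
  rw [← hμ0, hinf0, sub_self, mul_zero, zero_add]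
  have hα0 : 0 ≤ (w s(o, x) : ℝ) := (w s(o, x)).2.1
  have hα1 : (w s(o, x) : ℝ) ≤ 1 := (w s(o, x)).2.2
  have hβ0 : 0 ≤ (w s(o, y) : ℝ) := (w s(o, y)).2.1
  have hβ1 : (w s(o, y) : ℝ) ≤ 1 := (w s(o, y)).2.2
  have t1 : 0 ≤ (w s(o, x) : ℝ) * (1 - (w s(o, y) : ℝ)) *
      (μ0.real (openConn x b) - μ0.real (openConn a₀ b) +
        ∑ W ∈ nullSets A, μ0.real (clusterIs x W) * A.inf' hA (fun a' => μ0.real (openConnIn ((↑W : Set (Fin n))ᶜ) a' b))) :=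
    mul_nonneg (mul_nonneg hα0 (by linarith)) (by linarith)
  have t2 : 0 ≤ (1 - (w s(o, x) : ℝ)) * (w s(o, y) : ℝ) *
      (μ0.real (openConn y b) - μ0.real (openConn a₀ b) +
        ∑ W ∈ nullSets A, μ0.real (clusterIs y W) * A.inf' hA (fun a' => μ0.real (openConnIn ((↑W : Set (Fin n))ᶜ) a' b))) :=
    mul_nonneg (mul_nonneg (by linarith) hβ0) (by linarith)
  have t3 : 0 ≤ (w s(o, x) : ℝ) * (w s(o, y) : ℝ) *
      ((prodBernoulli (Function.update (pinW w {e : Sym2 (Fin n) | o ∈ e ∧ ¬ e.IsDiag} ∅) s(x, y) 1)).real (openConn x b) -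
        (prodBernoulli (Function.update (pinW w {e : Sym2 (Fin n) | o ∈ e ∧ ¬ e.IsDiag} ∅) s(x, y) 1)).real (openConn a₀ b) +
        ∑ W ∈ nullSets A, (prodBernoulli (Function.update (pinW w {e : Sym2 (Fin n) | o ∈ e ∧ ¬ e.IsDiag} ∅) s(x, y) 1)).real
            (clusterIs x W) *
          A.inf' hA (fun a' => (prodBernoulli (Function.update (pinW w {e : Sym2 (Fin n) | o ∈ e ∧ ¬ e.IsDiag} ∅) s(x, y) 1)).real
            (openConnIn ((↑W : Set (Fin n))ᶜ) a' b))) :=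
    mul_nonneg (mul_nonneg hα0 hβ0) (by linarith)
  linarith

end KNGoodSeries

end Summit.CriticalPhenomena.PercolationContinuityZ3.Theorems

end
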